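import Literature.AnabelianGeometry.EtaleTheta.SettingModelKummerCocycleContinuous
import HarnessLib

/-!
# The Kummer cocycle `κ_{−1} : G_{ℚ_p} → Ẑ` of the unit `−1` for the roots `ξ_{2N}`, and the identity
# `2·κ_{−1} = χ − 1` («`κ_{−1} = (χ − 1)/2`»)

S. Mochizuki, *The étale theta function …*, Publ. RIMS **45** (2009) [EtTh], §1, Prop. 1.5 (iii) p. 23:
"`log(O^×_K̈)`" — the Kummer classes of the units of `K̈`, among them `log(−1)`, enter the description of
`η̈^Θ + log(O^×_K̈)` and of the `Π^tp_Y/Π^tp_Ÿ`-move of `log(Ü)` [cite: MochizukiEtTh2009, Prop 1.5 (iii) p.23];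
J. Neukirch, *Algebraic Number Theory*, Ch. IV §3 (Kummer theory) [cite: NeukirchANT1999, Ch. IV §3].
abc-iut cell, layer L2, seat abc-iut-L2-t5 (gen 6; Tate-curve / Kummer lineage, F3c family), R78 cluster STAGE 2,
sub-input **(s3′)** of abc-iut-L2-t6's F7q (row request 11:13:18Z): at the Tate-shear model the generator
`β = inl(b)` of `Π^tp_Y/Π^tp_Ÿ` moves `log(Ü)` by `κ(−1)`, and F7q needs `κ(−1)` as an explicit `Ẑ`-valued cocycle
with its relation to `χ`. Over abc-iut-L2-t5's generic `kummerZH` (F3c-2 `SettingModelKummerCocycleP`): the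
roots of `−1` are CHOSEN to be the even components `ξ_{2N}` of F3c's cyclotome generator `cycGen p` (so that no
new choice enters), and then `κ_{−1}(σ)² = e(σ·ξ/ξ) = χ(σ)(ι1)·(ι1)⁻¹` in `Ẑ` — i.e. «`2κ_{−1} = χ − 1`».

* `negOneUnit p : ℚ̄_pˣ` (`= −1`), `negOneUnit_mem_fixedPoints`; `cycGen_two : ξ_2 = −1`;
* **`negOneRoots p : RootSystem (negOneUnit p)`** with `root N := ξ_{2N}` (`negOneRoots_root`);
* **`kappaNegOne p : GQp p → ZH`** `:= kummerZH (negOneRoots p) _` with `kappaNegOne_one`, the `χ`-cocycle law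
  `kappaNegOne_mul`, continuity `continuous_kappaNegOne`, the defining formula `apply_cycGen_two_mul`
  (`σ(ξ_{2N}) = ξ_N^{κ_{−1}(σ) mod N}·ξ_{2N}`), the level kernel **`level_kappaNegOne_eq_one_iff`**
  (`κ_{−1}(σ) ≡ 0 (N) ↔ χ_{2N}(σ) = 1`);
* **`kummerCocycle_negOneRoots_sq`** (in the cyclotome: `κ^Λ_{−1}(σ)² = σ·ξ/ξ`) and
  **`kappaNegOne_sq : kappaNegOne p σ ^ 2 = chi p σ (iotaZ (ofAdd 1)) * (iotaZ (ofAdd 1))⁻¹`**, with the evenness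
  corollary `level_two_chi_iotaZ_div`.

HONEST LABEL: classical Kummer theory inside a semi-synthetic model (consistency evidence only); nothing of [EtTh]
is asserted; nothing here bears on [IUTchIII] Cor. 3.12. Class (b) CONSTRUCTION file (defs `negOneUnit`,
`negOneRoots`, `kappaNegOne`; no instance, no notation, no Prop-valued definition).
-/

noncomputable section

namespace Literature.AnabelianGeometry.EtaleTheta.SettingModel

open Literature.AnabelianGeometry.SemiGraphs (GQp)

variable (p : ℕ) [Fact p.Prime]

/-! ### The unit `−1` and its chosen roots `ξ_{2N}` -/

/-- The unit `−1 ∈ ℚ̄_pˣ`. [cite: MochizukiEtTh2009, Prop 1.5 (iii) p.23] -/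
def negOneUnit : (PadicAlgCl p)ˣ := -1

/-- [cite: MochizukiEtTh2009, Prop 1.5 (iii) p.23] -/
@[simp] theorem coe_negOneUnit : ((negOneUnit p : (PadicAlgCl p)ˣ) : PadicAlgCl p) = -1 := rfl

/-- `−1` is fixed by every `σ ∈ G_{ℚ_p}`. [cite: NeukirchANT1999, Ch. IV §1] -/
theorem smul_negOneUnit (σ : GQp p) : σ • negOneUnit p = negOneUnit p :=
  Units.ext (by rw [AlgEquiv.smul_units_def, Units.coe_map, MonoidHom.coe_coe, coe_negOneUnit, map_neg, map_one])

/-- `−1 ∈ (ℚ̄_pˣ)^{G_{ℚ_p}}` (the hypothesis shape of `kummerZH`). [cite: NeukirchANT1999, Ch. IV §1] -/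
theorem negOneUnit_mem_fixedPoints :
    negOneUnit p ∈ MulAction.fixedPoints (⊤ : Subgroup (GQp p)) (PadicAlgCl p)ˣ :=
  mem_fixedPoints_top_of_forall (smul_negOneUnit p)

/-- **`ξ_2 = −1`**: the second component of F3c's cyclotome generator is the primitive square root of unity `−1`
(characteristic `0`). [cite: RibesZalesskii2010, Thm 2.7.1] -/
theorem cycGen_two : (cycGen p : ℕ+ → (PadicAlgCl p)ˣ) 2 = negOneUnit p := by
  haveI := charZero_padicAlgCl p
  have h := isPrimitiveRoot_coe_cycGen p 2
  exact Units.ext (by rw [coe_negOneUnit]; exact h.eq_neg_one_of_two_right)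

/-- **The CHOSEN compatible system of roots of `−1`: `(−1)^{1/N} := ξ_{2N}`** (compatibility
`ξ_{2NM}^M = ξ_{2N}` from the cyclotome, `ξ_{2·1} = ξ_2 = −1`). [cite: NeukirchANT1999, Ch. IV §3] -/
def negOneRoots : RootSystem (negOneUnit p) where
  root N := (cycGen p : ℕ+ → (PadicAlgCl p)ˣ) (2 * N)
  root_one := by rw [mul_one, cycGen_two]
  root_mul_pow N M := by
    have h := ((cyclotome.mem_iff _).mp (cycGen p).2).2 (2 * N) M
    rw [← mul_assoc]
    exact h

/-- [cite: NeukirchANT1999, Ch. IV §3] -/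
theorem negOneRoots_root (N : ℕ+) : (negOneRoots p).root N = (cycGen p : ℕ+ → (PadicAlgCl p)ˣ) (2 * N) := rfl

/-- `ξ_{2N}² = ξ_N` (cyclotome compatibility at `(N, 2)`). [cite: RibesZalesskii2010, Thm 2.7.1] -/
theorem cycGen_two_mul_sq (N : ℕ+) :
    (cycGen p : ℕ+ → (PadicAlgCl p)ˣ) (2 * N) ^ 2 = (cycGen p : ℕ+ → (PadicAlgCl p)ˣ) N := by
  have h := ((cyclotome.mem_iff _).mp (cycGen p).2).2 N 2
  rw [mul_comm] at h
  exact h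

/-! ### The cocycle `κ_{−1}` -/

/-- **The Kummer cocycle of `−1`**: `κ_{−1}(σ) := e((σ(ξ_{2N})/ξ_{2N})_N) ∈ Ẑ` (the generic `kummerZH` at the root
system `negOneRoots`). [cite: NeukirchANT1999, Ch. IV §3] -/
def kappaNegOne (σ : GQp p) : ZH := kummerZH (negOneRoots p) (negOneUnit_mem_fixedPoints p) σ

/-- [cite: NeukirchANT1999, Ch. IV §3] -/
theorem kappaNegOne_def (σ : GQp p) :
    kappaNegOne p σ = kummerZH (negOneRoots p) (negOneUnit_mem_fixedPoints p) σ := rfl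

/-- `κ_{−1}(1) = 1`. [cite: NeukirchANT1999, Ch. IV §3] -/
theorem kappaNegOne_one : kappaNegOne p 1 = 1 := kummerZH_one _ _

/-- The `χ`-cocycle law `κ_{−1}(στ) = κ_{−1}(σ) · χ(σ)(κ_{−1}(τ))`. [cite: NeukirchANT1999, Ch. IV §3] -/
theorem kappaNegOne_mul (σ τ : GQp p) :
    kappaNegOne p (σ * τ) = kappaNegOne p σ * chi p σ (kappaNegOne p τ) := kummerZH_mul _ _ σ τ

/-- `κ_{−1}` is continuous (Krull topology). [cite: NeukirchANT1999, Ch. IV §1] -/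
theorem continuous_kappaNegOne : Continuous (kappaNegOne p) := continuous_kummerZH p _ _

/-- `κ_{−1} mod N` is locally constant. [cite: NeukirchANT1999, Ch. IV §1] -/
theorem isLocallyConstant_level_kappaNegOne (N : ℕ+) :
    IsLocallyConstant fun σ : GQp p => ZHatLevel.level N (kappaNegOne p σ) :=
  isLocallyConstant_level_kummerZH _ _ N

/-- **The defining formula** `σ(ξ_{2N}) = ξ_N ^ (κ_{−1}(σ) mod N) · ξ_{2N}`. [cite: NeukirchANT1999, Ch. IV §3] -/
theorem apply_cycGen_two_mul (σ : GQp p) (N : ℕ+) :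
    σ (((cycGen p : ℕ+ → (PadicAlgCl p)ˣ) (2 * N) : (PadicAlgCl p)ˣ) : PadicAlgCl p) =
      (((cycGen p : ℕ+ → (PadicAlgCl p)ˣ) N : (PadicAlgCl p)ˣ) : PadicAlgCl p) ^
          (Multiplicative.toAdd (ZHatLevel.level N (kappaNegOne p σ))).val *
        (((cycGen p : ℕ+ → (PadicAlgCl p)ˣ) (2 * N) : (PadicAlgCl p)ˣ) : PadicAlgCl p) :=
  apply_root_eq (negOneRoots p) (negOneUnit_mem_fixedPoints p) σ N

/-- **The level-`N` kernel of `κ_{−1}` is the level-`2N` kernel of `χ`**: `κ_{−1}(σ) ≡ 0 (N) ↔ σ(ξ_{2N}) = ξ_{2N}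
↔ χ_{2N}(σ) = 1`. [cite: NeukirchANT1999, Ch. IV §3] -/
theorem level_kappaNegOne_eq_one_iff (σ : GQp p) (N : ℕ+) :
    ZHatLevel.level N (kappaNegOne p σ) = 1 ↔ ZHatLevel.levelChar (2 * N) (chi p σ) = 1 := by
  rw [kappaNegOne_def, level_kummerZH_eq_one_iff, negOneRoots_root]
  have hξ := isPrimitiveRoot_coe_cycGen p (2 * N)
  constructor
  · intro h
    have h1 := levelChar_chi_eq_of_isPrimitiveRoot p σ (2 * N) hξ (c := 1) (by rw [pow_one]; exact h)
    rw [h1, Nat.cast_one]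
  · intro h
    have h1 := apply_eq_pow_levelChar_chi p σ (2 * N) hξ.pow_eq_one
    have hlt : 1 < ((2 * N : ℕ+) : ℕ) := by
      rw [PNat.mul_coe, show ((2 : ℕ+) : ℕ) = 2 from rfl]
      have := N.pos
      omega
    rw [h, ZMod.val_one_eq_one_mod, Nat.mod_eq_of_lt hlt, pow_one] at h1
    exact h1

/-! ### `2·κ_{−1} = χ − 1` -/

/-- **In the cyclotome: `κ^Λ_{−1}(σ)² = σ·ξ/ξ`** — componentwise `((σ ξ_{2N})/ξ_{2N})² = (σ ξ_N)/ξ_N` because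
`ξ_{2N}² = ξ_N`. [cite: NeukirchANT1999, Ch. IV §3] -/
theorem kummerCocycle_negOneRoots_sq (σ : GQp p) :
    (negOneRoots p).kummerCocycle (H := (⊤ : Subgroup (GQp p))) (negOneUnit_mem_fixedPoints p)
        ⟨σ, Subgroup.mem_top σ⟩ ^ 2 = σ • cycGen p / cycGen p := by
  refine Subtype.ext (funext fun n => ?_)
  show ((((negOneRoots p).kummerCocycle (H := (⊤ : Subgroup (GQp p))) (negOneUnit_mem_fixedPoints p)
      ⟨σ, Subgroup.mem_top σ⟩ : cyclotome (PadicAlgCl p)ˣ) : ℕ+ → (PadicAlgCl p)ˣ) n) ^ 2 =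
    σ • (cycGen p : ℕ+ → (PadicAlgCl p)ˣ) n / (cycGen p : ℕ+ → (PadicAlgCl p)ˣ) n
  rw [kummerCocycle_top_apply, negOneRoots_root, div_pow, ← smul_pow', cycGen_two_mul_sq]

/-- **`κ_{−1}(σ)² = χ(σ)(ι1) · (ι1)⁻¹` in `Ẑ`** («`2κ_{−1} = χ − 1`», i.e. «`κ_{−1} = (χ − 1)/2`»): read
`κ^Λ_{−1}(σ)² = σ·ξ/ξ` through `e` (`e(σ·ξ) = χ(σ)(e ξ)`, `e ξ = ι1`). [cite: MochizukiEtTh2009, Prop 1.5 (iii) p.23] -/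
theorem kappaNegOne_sq (σ : GQp p) :
    kappaNegOne p σ ^ 2 =
      chi p σ (iotaZ (Multiplicative.ofAdd 1)) * (iotaZ (Multiplicative.ofAdd 1))⁻¹ := by
  rw [kappaNegOne_def, kummerZH_def, ← map_pow, kummerCocycle_negOneRoots_sq, map_div, cycEquiv_smul,
    cycEquiv_cycGen, div_eq_mul_inv]
  rfl

/-- Evenness of `χ(σ)(ι1)·(ι1)⁻¹`: its level-`2` image is trivial (it is a square) — the membership criterion of
abc-iut-w5-d171's `sqHom.range` / `half`. [cite: MochizukiEtTh2009, Prop 1.5 (iii) p.23] -/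
theorem level_two_chi_iotaZ_div (σ : GQp p) :
    ZHatLevel.level 2 (chi p σ (iotaZ (Multiplicative.ofAdd 1)) * (iotaZ (Multiplicative.ofAdd 1))⁻¹) = 1 := by
  rw [← kappaNegOne_sq, map_pow]
  generalize ZHatLevel.level 2 (kappaNegOne p σ) = m
  have h : ∀ m : Multiplicative (ZMod 2), m ^ 2 = 1 := by decide
  exact h m

/-- The square identity for products: `κ_{−1}(σ)^{2k} = (χ(σ)(ι1)·(ι1)⁻¹)^k` for every `k : ℤ`.
[cite: MochizukiEtTh2009, Prop 1.5 (iii) p.23] -/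
theorem kappaNegOne_zpow_two_mul (σ : GQp p) (k : ℤ) :
    kappaNegOne p σ ^ (2 * k) =
      (chi p σ (iotaZ (Multiplicative.ofAdd 1)) * (iotaZ (Multiplicative.ofAdd 1))⁻¹) ^ k := by
  rw [zpow_mul, zpow_ofNat, kappaNegOne_sq]

end Literature.AnabelianGeometry.EtaleTheta.SettingModel

end
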